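import Mathlib
import HarnessLib
import Summits.HubbardSuperconductivity.HubbardSuperconductivity.Theorems.KLProgrammeKLRegimeFatFrameInstance

/-!
# Route `KLProgramme` — engine support, route (L2), FAT layer: the overlap count of the fat family — a fat multiplier `F̃_ω` at scale `m+1`
# has a common support point with at most `9` fat multipliers `F̃_{ω′}` of the same scale

Cell `gate-hubbard-kl`, seat hubbard-kl-k3c2-p3; gen-4 ENGINE child stmt-HubbardSuperconductivity-19855 (`stub_engine_step_norms`, propagator
`α_n`: the `novl` of `rowSum_norm_pullback_sliceCT_le_alpha`).  If `F̃_ω(k)·F̃_{ω′}(k) ≠ 0` then some `ζ̃_{m+1,a}`, `a ∈ S_ω`, and some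
`ζ̃_{m+1,b}`, `b ∈ S_{ω′}`, are both nonzero at `θ(k)`; by `sectorIndex_near_of_sectorWeightCirc_ne_zero` both `a` and `b` are within `1` of
the sector index of `θ(k)` modulo `N`, so `ω′ ≡ ω + Δ (mod N)` with `|Δ| ≤ 4`:

* **`card_overlap_bgmFat_le_nine`** — `#{ω′ : ∃ k, F̃_ω(k)F̃_{ω′}(k) ≠ 0} ≤ 9`, and the version with the slots exchanged
  `card_overlap_bgmFat_le_nine'`.

Everything is proved; no definitions, no named facts. [folklore]

References: G. Benfatto, A. Giuliani, V. Mastropietro, Ann. Henri Poincaré 7 (2006) 809–898, §2.7 (2.66), (2.71a).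
-/

noncomputable section

namespace Summit.HubbardSuperconductivity.HubbardSuperconductivity.Theorems.TorusFourierL2

set_option linter.dupNamespace false -- summit = problem name (single-conjunct summit), D-0017

open Set Finset Literature.MathematicalPhysics.QuantumLattice Literature.MathematicalPhysics.QuantumLattice.BandSectorCounting
open Literature.MathematicalPhysics.QuantumLattice.FermiRG Literature.Probability.LatticeModels Literature.Analysis.SpecialFunctions
open Summit.HubbardSuperconductivity.HubbardSuperconductivity.Theorems.DispersionFlow
open Summit.HubbardSuperconductivity.HubbardSuperconductivity.Theorems.KLProgrammeLegKernels
open Summit.HubbardSuperconductivity.HubbardSuperconductivity.Theorems.PerturbedFermiCurve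
open scoped Real

section Overlap

open Classical

variable {L M : ℕ} [NeZero L] {μ e₀ β : ℝ} {K : TrigPolyC4v} (m : ℕ)

omit [NeZero L] in
/-- **Index arithmetic of an overlapping fat pair**: if `F̃_ω(k)·F̃_{ω′}(k) ≠ 0` then `N ∣ (ω′ − ω − Δ)` for some `|Δ| ≤ 4`. [folklore] -/
theorem exists_shift_of_bgmFat_mul_ne_zero (ω ω' : Fin (sectorCount (m + 1))) (k : FreqMomentum L M)
    (h : bgmFatMultiplier L M e₀ β (nambuXiCT L μ K) (m + 1) ω k * bgmFatMultiplier L M e₀ β (nambuXiCT L μ K) (m + 1) ω' k ≠ 0) :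
    ∃ Δ : ℤ, |Δ| ≤ 4 ∧ (sectorCount (m + 1) : ℤ) ∣ (((ω' : ℕ) : ℤ) - ((ω : ℕ) : ℤ) - Δ) := by
  obtain ⟨h1, h2⟩ := mul_ne_zero_iff.1 h
  obtain ⟨a', ha', hζa⟩ := bgmFat_support_angle (μ := μ) (e₀ := e₀) (β := β) m ω k h1
  obtain ⟨b', hb', hζb⟩ := bgmFat_support_angle (μ := μ) (e₀ := e₀) (β := β) m ω' k h2
  rw [Finset.mem_filter] at ha' hb'
  obtain ⟨-, δ₁, hδ₁, hdiv₁⟩ := ha'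
  obtain ⟨-, δ₂, hδ₂, hdiv₂⟩ := hb'
  obtain ⟨d₁, hd₁, hs₁⟩ := sectorIndex_near_of_sectorWeightCirc_ne_zero hζa
  obtain ⟨d₂, hd₂, hs₂⟩ := sectorIndex_near_of_sectorWeightCirc_ne_zero hζb
  refine ⟨d₁ + δ₁ - d₂ - δ₂, ?_, ?_⟩
  · rw [abs_le] at hδ₁ hδ₂ hd₁ hd₂ ⊢; omega
  · -- ω′ − ω − Δ = (s − a − d₁)·(−1) ... combine the four divisibilities
    have e : ((ω' : ℕ) : ℤ) - ((ω : ℕ) : ℤ) - (d₁ + δ₁ - d₂ - δ₂) =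
        ((sectorIndex (m + 1) (momentumAngle L k.2) : ℤ) - ((a' : ℕ) : ℤ) - d₁) - ((sectorIndex (m + 1) (momentumAngle L k.2) : ℤ) - ((b' : ℕ) : ℤ) - d₂)
          + (((a' : ℕ) : ℤ) - ((ω : ℕ) : ℤ) - δ₁) - (((b' : ℕ) : ℤ) - ((ω' : ℕ) : ℤ) - δ₂) := by ring
    rw [e]
    exact ((hs₁.sub hs₂).add hdiv₁).sub hdiv₂

/-- **At most `9` fat multipliers overlap a given one** (second slot varying). [cite: BenfattoGiulianiMastropietro2006, §2.7 (2.71a)] -/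
theorem card_overlap_bgmFat_le_nine (ω : Fin (sectorCount (m + 1))) :
    ((univ : Finset (Fin (sectorCount (m + 1)))).filter (fun ω' : Fin (sectorCount (m + 1)) =>
      ∃ k : FreqMomentum L M, bgmFatMultiplier L M e₀ β (nambuXiCT L μ K) (m + 1) ω k *
        bgmFatMultiplier L M e₀ β (nambuXiCT L μ K) (m + 1) ω' k ≠ 0)).card ≤ 9 := by
  have hNpos : 0 < sectorCount (m + 1) := sectorCount_pos (m + 1)
  -- inject the labels into `ℤ` and land in the image of `[-4, 4]` under `Δ ↦ (ω + Δ) mod N`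
  have hmap : ∀ ω' ∈ (univ : Finset (Fin (sectorCount (m + 1)))).filter (fun ω' : Fin (sectorCount (m + 1)) =>
      ∃ k : FreqMomentum L M, bgmFatMultiplier L M e₀ β (nambuXiCT L μ K) (m + 1) ω k *
        bgmFatMultiplier L M e₀ β (nambuXiCT L μ K) (m + 1) ω' k ≠ 0),
      (((ω' : ℕ) : ℤ)) ∈ (Finset.Icc (-4 : ℤ) 4).image (fun Δ : ℤ => (((ω : ℕ) : ℤ) + Δ) % (sectorCount (m + 1) : ℤ)) := by
    intro ω' hω'
    rw [Finset.mem_filter] at hω'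
    obtain ⟨k, hk⟩ := hω'.2
    obtain ⟨Δ, hΔ, hdvd⟩ := exists_shift_of_bgmFat_mul_ne_zero (μ := μ) (e₀ := e₀) (β := β) m ω ω' k hk
    rw [Finset.mem_image]
    refine ⟨Δ, by rw [Finset.mem_Icc]; rw [abs_le] at hΔ; exact hΔ, ?_⟩
    have h := eq_emod_of_dvd_sub (s := ((ω : ℕ) : ℤ) + Δ) (ω := ((ω' : ℕ) : ℤ)) (d := 0) (by positivity) (by exact_mod_cast ω'.isLt)
      (by obtain ⟨q, hq⟩ := hdvd; exact ⟨-q, by linarith⟩)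
    rw [sub_zero] at h
    exact h.symm
  have hinj : Set.InjOn (fun ω' : Fin (sectorCount (m + 1)) => ((ω' : ℕ) : ℤ))
      ((univ : Finset (Fin (sectorCount (m + 1)))).filter (fun ω' : Fin (sectorCount (m + 1)) =>
        ∃ k : FreqMomentum L M, bgmFatMultiplier L M e₀ β (nambuXiCT L μ K) (m + 1) ω k *
          bgmFatMultiplier L M e₀ β (nambuXiCT L μ K) (m + 1) ω' k ≠ 0) : Set (Fin (sectorCount (m + 1)))) := by
    intro x _ y _ h
    have h' : ((x : ℕ) : ℤ) = ((y : ℕ) : ℤ) := h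
    exact Fin.ext (by exact_mod_cast h')
  calc _ ≤ ((Finset.Icc (-4 : ℤ) 4).image (fun Δ : ℤ => (((ω : ℕ) : ℤ) + Δ) % (sectorCount (m + 1) : ℤ))).card :=
        Finset.card_le_card_of_injOn _ hmap hinj
    _ ≤ (Finset.Icc (-4 : ℤ) 4).card := Finset.card_image_le
    _ = 9 := by simp

/-- **At most `9` fat multipliers overlap a given one** (first slot varying). [cite: BenfattoGiulianiMastropietro2006, §2.7 (2.71a)] -/
theorem card_overlap_bgmFat_le_nine' (ω' : Fin (sectorCount (m + 1))) :
    ((univ : Finset (Fin (sectorCount (m + 1)))).filter (fun ω : Fin (sectorCount (m + 1)) =>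
      ∃ k : FreqMomentum L M, bgmFatMultiplier L M e₀ β (nambuXiCT L μ K) (m + 1) ω k *
        bgmFatMultiplier L M e₀ β (nambuXiCT L μ K) (m + 1) ω' k ≠ 0)).card ≤ 9 := by
  refine le_trans (Finset.card_le_card (Finset.monotone_filter_right _ fun ω _ hω => ?_))
    (card_overlap_bgmFat_le_nine (L := L) (M := M) (K := K) (μ := μ) (e₀ := e₀) (β := β) m ω')
  obtain ⟨k, hk⟩ := hω
  exact ⟨k, by rwa [mul_comm] at hk⟩

end Overlap

end Summit.HubbardSuperconductivity.HubbardSuperconductivity.Theorems.TorusFourierL2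

end
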